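import Summits.Schanuel.Schanuel.Theorems.SoloInformedRoyAxisCriterion
import Summits.Schanuel.Schanuel.Theorems.SoloBlindPadeExponent

/-!
# The exact parameter window of Roy's criterion, and Nguyen's 2009 refinement

Roy 2001 proves `Conjecture 2 (rank l) ⟺ Schanuel (rank l)` on his window (1) (`RoyAdmissible`:
`max{1,t₀,2t₁} < min{s₀,2s₁}`, `max{s₀, s₁+t₁} < u < ½(1+t₀+t₁)`).  Nguyen Ngoc Ai Van, *A refined
criterion for Schanuel's conjecture*, Chamchuri J. Math. 1 (2009) no. 2, 25–29 [Nguyen2009],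
states the same equivalence (Thm. 1.4, p. 27) on the wider window (2) of Conjecture 1.3 (p. 26),
`max{1,t₀,2t₁} < min{s₀,2s₁} < u < ½(1+t₀+t₁)`: Roy's lower bound `max{s₀, s₁+t₁} < u` becomes
`min{s₀,2s₁} < u`; the `(t₀,t₁)`-range and the precision ceiling `u < ½(1+t₀+t₁)` are unchanged
(p. 27).  "Criterion at `p`" = Roy's Conjecture 2 = Nguyen's Conjecture 1.3 for rank `l` at ONE
point `p = (s₀,s₁,t₀,t₁,u)`: `∀ y α, y ℚ-free → α_j ≠ 0 → RoyHypothesis y α s₀ s₁ t₀ t₁ u →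
trdeg ℚ(y,α) ≥ l` (written out in every statement; no `Prop` definitions are introduced).
Kernel facts recorded here:

* `le_trdeg_of_royHypothesis[_nguyen]` — `Schanuel (rank l) ⇒ criterion at p` for every `p` with
  `0 < t₁`, `max{1,t₀,2t₁} < s₀`, `t₁ ≤ s₁`, `2t₁ < u`: NO upper bound on `u`, no coupling of `u`
  with `s₀, s₁` (degree-range form of Roy's Thm. 1); contains window (2) (Thm. 1.4, second half).
* `schanuelRank_of_criterion_sharp`, `nguyen_thm14_sharp`, `nguyen_thm14_forall` — `criterion at
  p ⇒ Schanuel (rank l)` for positive `p` with `max{1,t₀,2t₁} < min{s₀,2s₁}`, `u < ½(1+t₀+t₁)` and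
  IN ADDITION `max{s₀, s₁+t₁} < ½(1+t₀+t₁)` (window (2♯); no lower bound on `u` needed):
  Waldschmidt's construction (`royHypothesis_exp'`) at the Roy-admissible point with
  `u' = ½(max{s₀, s₁+t₁, u} + ½(1+t₀+t₁))` plus antitonicity in `u`.  (2♯) strictly contains (1)
  and contains the example family of [Nguyen2009, p. 27] (`nguyen_example`); Thm. 1.4 holds
  pointwise on (2♯) and in the `∀`-over-(2) reading.
* (imported) `not_royHypothesis_of_lt`, `royCriterionAt_of_lt_s₀` — landed independently in the
  tree file `SoloBlindPadeExponent` and reused here, not restated: for `t₀ + t₁ < s₀` the hypothesis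
  is UNSATISFIABLE at every point `(y, α)`, every rank, every `s₁, u` (at the translate `m = 0` the
  values `(D^k P_N)(0,1)` are integers `≤ e^{-N^u} < 1`, hence `0` for all `k ≤ N^{s₀}`, against the
  zero-order bound for `P(z, e^z)` at one point — equally, Philippon's estimate `roy_no_exact_zeros`
  with `M = 0`).  Window (2) contains such `p` (`s₀` is unbounded in (2) as soon as `2s₁ < u`), where
  the criterion therefore holds vacuously; hence
* `nguyen_thm14_literal_iff_schanuel` — **the first half of [Nguyen2009, Thm. 1.4] read literally
  ("Conjecture 1.3 for some `l` and SOME choice of parameters satisfying (2) ⇒ Schanuel for `l`")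
  is equivalent to Schanuel's conjecture itself.**  The printed proof (p. 28: Thm. 2.2 with
  `Δ = N`, `r = 1 + cN^{s₁}`, `T_i = N^{t_i}`, `U = 2N^u`) needs `K > ErT₁ ≍ N^{s₁+t₁}` against
  Siegel's `K² log T₁ < Δ(T₀+1)(T₁+1)`, i.e. `s₁ + t₁ < ½(1+t₀+t₁)`, and `s₀` below the smallness
  exponent: it proves exactly the (2♯) statement.  `thm3_numerology_eventually_false`: on the part
  `s₁ + t₁ > ½(1+t₀+t₁)` of (2) the construction tool (Roy 2001 Thm. 3) cannot run on a disc
  containing the translates, for any smallness target.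

Consequence for the typed door `Schanuel ↔ ∀ l, RoyCriterion l` (`Roy2001_iff_holds`): the ceiling
`u < ½(1+t₀+t₁)` is intrinsic (Dirichlet/Siegel exponent) and NOT moved by [Nguyen2009]; the
refinement decouples `u` from the translate/derivative ranges inside (2♯).  (Waldschmidt, LNM 2313
(2022) pp. 588–589, cites it as "again equivalent to Schanuel's conjecture": true in the `∀`
reading and pointwise on (2♯); pointwise for `t₀ + t₁ < s₀` both sides are Schanuel's conjecture.)
References: [Nguyen2009] Conj. 1.3, (2), Thm. 1.4, 2.1, 2.2, p. 28; [Roy2001] (1), Conj. 2,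
Thm. 1, Thm. 3, §5.
-/

noncomputable section

open MvPolynomial Filter Complex
open Literature.NumberTheory.Transcendental

namespace Summit.Schanuel.Schanuel.Theorems

/-! ### The windows -/

/-- Nguyen's example (p. 27) at `ε = 1/16`: `p = (s₀, s₁, t₀, t₁, u) = (21/20, 9/16, 25/24, 25/48,
17/16)` (`s₀ ∈ (1 + 2ε/3, 1 + ε)`) lies in window (2) (`max{1, t₀, 2t₁} = 25/24 < min{s₀, 2s₁} =
21/20 < u = 17/16 < ½(1+t₀+t₁) = 123/96`), NOT in Roy's window (1) (`s₁ + t₁ = 13/12 > u`), and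
in window (2♯) (`max{s₀, s₁ + t₁} = 13/12 < 123/96`). [cite: Nguyen2009, p. 27] -/
theorem nguyen_example :
    max (1 : ℝ) (max (25/24) (2 * (25/48))) < min (21/20) (2 * (9/16)) ∧
      min (21/20 : ℝ) (2 * (9/16)) < 17/16 ∧ (17/16 : ℝ) < (1 + 25/24 + 25/48) / 2 ∧
      ¬ RoyAdmissible (21/20) (9/16) (25/24) (25/48) (17/16) ∧
      max (21/20 : ℝ) (9/16 + 25/48) < (1 + 25/24 + 25/48) / 2 := by
  refine ⟨?_, ?_, by norm_num, fun h => ?_, ?_⟩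
  · simp only [max_lt_iff, lt_min_iff]; norm_num
  · simp only [min_lt_iff]; norm_num
  · have := (max_lt_iff.1 h.2.2.2.2.2.2.1).2
    norm_num at this
  · simp only [max_lt_iff]; norm_num

/-! ### The half `Schanuel ⇒ criterion`: no ceiling, no coupling -/

/-- **Schanuel (rank `l`) ⇒ Roy's criterion at `p`**, for every parameter point with `0 < t₁`,
`max{1, t₀, 2t₁} < s₀`, `t₁ ≤ s₁` and `2t₁ < u` — with NO upper bound on `u` and no condition
linking `u` to `s₀, s₁`: the hypothesis restricted to the axis translates `m·e_j`, `m ≤ N^{t₁}`,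
already forces `α_j^{d} = e^{d y_j}` for some `d ≥ 1` (degree-range form of Roy's Theorem 1), and
Schanuel in torsion-twisted form concludes. [cite: Roy2001, Thm. 1, §5 (1°); Nguyen2009, Thm. 2.1] -/
theorem le_trdeg_of_royHypothesis {l : ℕ} (hS : SchanuelRank l) {s₀ s₁ t₀ t₁ u : ℝ}
    (ht₁ : 0 < t₁) (h1s₀ : 1 < s₀) (ht₀s₀ : t₀ < s₀) (h2t₁s₀ : 2 * t₁ < s₀) (ht₁s₁ : t₁ ≤ s₁)
    (h2t₁u : 2 * t₁ < u) {y α : Fin l → ℂ} (hy : LinearIndependent ℚ y) (hα : ∀ j, α j ≠ 0)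
    (hhyp : RoyHypothesis y α s₀ s₁ t₀ t₁ u) :
    (l : Cardinal) ≤ Algebra.trdeg ℚ ↥(IntermediateField.adjoin ℚ (Set.range y ∪ Set.range α)) :=
  le_trdeg_of_forall_royConditionA hS hy fun j =>
    royConditionA_of_royConditionB_deg (hα j) (by linarith) ht₁ (by linarith) h1s₀ ht₀s₀ h2t₁s₀
      h2t₁u (royConditionB_mono (y j) (α j) ht₁s₁ (royConditionB_of_royHypothesis hhyp j))

/-- **[Nguyen2009, Theorem 1.4, second half] (kernel form):** Schanuel's conjecture for rank `l`
implies Conjecture 1.3 for rank `l` at every point with `0 < t₁` and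
`max{1, t₀, 2t₁} < min{s₀, 2s₁} < u` — in particular at every point of window (2); the upper
bound `u < ½(1+t₀+t₁)` is not used. [cite: Nguyen2009, Thm. 1.4, Thm. 2.1] -/
theorem le_trdeg_of_royHypothesis_nguyen {l : ℕ} (hS : SchanuelRank l) {s₀ s₁ t₀ t₁ u : ℝ}
    (ht₁ : 0 < t₁) (h1 : max 1 (max t₀ (2 * t₁)) < min s₀ (2 * s₁)) (h2 : min s₀ (2 * s₁) < u)
    {y α : Fin l → ℂ} (hy : LinearIndependent ℚ y) (hα : ∀ j, α j ≠ 0)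
    (hhyp : RoyHypothesis y α s₀ s₁ t₀ t₁ u) :
    (l : Cardinal) ≤ Algebra.trdeg ℚ ↥(IntermediateField.adjoin ℚ (Set.range y ∪ Set.range α)) := by
  have hmax := max_lt_iff.1 h1
  have hmax' := max_lt_iff.1 hmax.2
  have h1s₀ : 1 < s₀ := lt_of_lt_of_le hmax.1 (min_le_left _ _)
  have ht₀s₀ : t₀ < s₀ := lt_of_lt_of_le hmax'.1 (min_le_left _ _)
  have h2t₁s₀ : 2 * t₁ < s₀ := lt_of_lt_of_le hmax'.2 (min_le_left _ _)
  have h2t₁s₁ : 2 * t₁ < 2 * s₁ := lt_of_lt_of_le hmax'.2 (min_le_right _ _)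
  have h2t₁u : 2 * t₁ < u := hmax'.2.trans h2
  exact le_trdeg_of_royHypothesis hS ht₁ h1s₀ ht₀s₀ h2t₁s₀ (by linarith) h2t₁u hy hα hhyp

/-! ### The half `criterion ⇒ Schanuel`: window (2♯) -/

/-- The hypothesis of Conjecture 2 / 1.3 is antitone in the precision exponent `u`.
[cite: Roy2001, Conjecture 2] -/
theorem royHypothesis_anti {l : ℕ} (y α : Fin l → ℂ) {s₀ s₁ t₀ t₁ u u' : ℝ} (huu : u ≤ u')
    (h : RoyHypothesis y α s₀ s₁ t₀ t₁ u') : RoyHypothesis y α s₀ s₁ t₀ t₁ u := by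
  unfold RoyHypothesis at h ⊢
  filter_upwards [h, eventually_ge_atTop 1] with N hN hN1
  obtain ⟨P, hP0, hd0, hd1, hH, hval⟩ := hN
  refine ⟨P, hP0, hd0, hd1, hH, fun k m hk hm => (hval k m hk hm).trans ?_⟩
  have hN1' : (1 : ℝ) ≤ (N : ℝ) := by exact_mod_cast hN1
  have := Real.rpow_le_rpow_of_exponent_le hN1' huu
  exact Real.exp_le_exp.2 (by linarith)

/-- **Criterion at a Roy-admissible point ⇒ Schanuel (rank `l`)** (Roy 2001, §5, 2°, pointwise):
the hypothesis holds at `(y, e^y)` by Waldschmidt's construction (`royHypothesis_exp'`).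
[cite: Roy2001, §5 (2°)] -/
theorem schanuelRank_of_criterion_roy {l : ℕ} {s₀ s₁ t₀ t₁ u : ℝ}
    (hadm : RoyAdmissible s₀ s₁ t₀ t₁ u)
    (hC : ∀ (y α : Fin l → ℂ), LinearIndependent ℚ y → (∀ j, α j ≠ 0) →
      RoyHypothesis y α s₀ s₁ t₀ t₁ u →
        (l : Cardinal) ≤ Algebra.trdeg ℚ
          ↥(IntermediateField.adjoin ℚ (Set.range y ∪ Set.range α))) :
    SchanuelRank l := fun y hy =>
  hC y (cexp ∘ y) hy (fun _ => Complex.exp_ne_zero _) (royHypothesis_exp' y hadm)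

/-- **Criterion at a point of window (2♯) ⇒ Schanuel (rank `l`)** — the corrected first half of
[Nguyen2009, Thm. 1.4]: for positive `p = (s₀, s₁, t₀, t₁, u)` with `max{1, t₀, 2t₁} < min{s₀, 2s₁}`,
`u < ½(1+t₀+t₁)` and moreover `max{s₀, s₁ + t₁} < ½(1 + t₀ + t₁)` (no lower bound on `u` is
needed), Conjecture 1.3 at `p` for rank `l` implies Schanuel for rank `l`.  Proof: the point
`p' = (s₀, s₁, t₀, t₁, u')`, `u' = ½(max{s₀, s₁+t₁, u} + ½(1+t₀+t₁))`, is Roy-admissible, the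
hypothesis holds at `(y, e^y)` for `p'`, hence for `p` (`u ≤ u'`).
[cite: Nguyen2009, Thm. 1.4, Thm. 2.2, p. 28; Roy2001, §5 (2°)] -/
theorem schanuelRank_of_criterion_sharp {l : ℕ} {s₀ s₁ t₀ t₁ u : ℝ}
    (hs₀ : 0 < s₀) (hs₁ : 0 < s₁) (ht₀ : 0 < t₀) (ht₁ : 0 < t₁) (hu : 0 < u)
    (h1 : max 1 (max t₀ (2 * t₁)) < min s₀ (2 * s₁)) (h3 : u < (1 + t₀ + t₁) / 2)
    (hsharp : max s₀ (s₁ + t₁) < (1 + t₀ + t₁) / 2)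
    (hC : ∀ (y α : Fin l → ℂ), LinearIndependent ℚ y → (∀ j, α j ≠ 0) →
      RoyHypothesis y α s₀ s₁ t₀ t₁ u →
        (l : Cardinal) ≤ Algebra.trdeg ℚ
          ↥(IntermediateField.adjoin ℚ (Set.range y ∪ Set.range α))) :
    SchanuelRank l := by
  set M : ℝ := max (max s₀ (s₁ + t₁)) u with hM
  set u' : ℝ := (M + (1 + t₀ + t₁) / 2) / 2 with hu'
  have hM1 : max s₀ (s₁ + t₁) ≤ M := le_max_left _ _
  have hM2 : u ≤ M := le_max_right _ _
  have hM3 : M < (1 + t₀ + t₁) / 2 := max_lt hsharp h3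
  have huu' : u ≤ u' := by rw [hu']; linarith
  have hadm : RoyAdmissible s₀ s₁ t₀ t₁ u' := by
    refine ⟨hs₀, hs₁, ht₀, ht₁, by linarith, h1, ?_, by rw [hu']; linarith⟩
    exact lt_of_le_of_lt hM1 (by rw [hu']; linarith)
  intro y hy
  exact hC y (cexp ∘ y) hy (fun _ => Complex.exp_ne_zero _)
    (royHypothesis_anti y _ huu' (royHypothesis_exp' y hadm))

/-- **Theorem 1.4 of [Nguyen2009], pointwise on window (2♯).** For `p` in window (2) with
`max{s₀, s₁ + t₁} < ½(1 + t₀ + t₁)`: Conjecture 1.3 at `p` for rank `l` ⟺ Schanuel for rank `l`.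
Window (2♯) strictly contains Roy's window (1) (`nguyen_example`). [cite: Nguyen2009, Thm. 1.4] -/
theorem nguyen_thm14_sharp (l : ℕ) {s₀ s₁ t₀ t₁ u : ℝ}
    (hs₀ : 0 < s₀) (hs₁ : 0 < s₁) (ht₀ : 0 < t₀) (ht₁ : 0 < t₁) (hu : 0 < u)
    (h1 : max 1 (max t₀ (2 * t₁)) < min s₀ (2 * s₁)) (h2 : min s₀ (2 * s₁) < u)
    (h3 : u < (1 + t₀ + t₁) / 2) (hsharp : max s₀ (s₁ + t₁) < (1 + t₀ + t₁) / 2) :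
    (∀ (y α : Fin l → ℂ), LinearIndependent ℚ y → (∀ j, α j ≠ 0) →
      RoyHypothesis y α s₀ s₁ t₀ t₁ u →
        (l : Cardinal) ≤ Algebra.trdeg ℚ
          ↥(IntermediateField.adjoin ℚ (Set.range y ∪ Set.range α))) ↔ SchanuelRank l :=
  ⟨schanuelRank_of_criterion_sharp hs₀ hs₁ ht₀ ht₁ hu h1 h3 hsharp,
    fun hS _ _ hy hα hhyp => le_trdeg_of_royHypothesis_nguyen hS ht₁ h1 h2 hy hα hhyp⟩

/-- **Theorem 1.4 of [Nguyen2009] in the `∀`-over-(2) reading holds**: Conjecture 1.3 for rank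
`l` at EVERY point of window (2) ⟺ Schanuel for rank `l` (`→` through the Roy-admissible point
`(1.3, 0.7, 1.2, 0.5, 1.32) ∈ (1) ⊆ (2)`). [cite: Nguyen2009, Thm. 1.4; Roy2001, §1] -/
theorem nguyen_thm14_forall (l : ℕ) :
    (∀ s₀ s₁ t₀ t₁ u : ℝ, 0 < s₀ → 0 < s₁ → 0 < t₀ → 0 < t₁ → 0 < u →
      max 1 (max t₀ (2 * t₁)) < min s₀ (2 * s₁) → min s₀ (2 * s₁) < u → u < (1 + t₀ + t₁) / 2 →
      ∀ (y α : Fin l → ℂ), LinearIndependent ℚ y → (∀ j, α j ≠ 0) →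
        RoyHypothesis y α s₀ s₁ t₀ t₁ u →
          (l : Cardinal) ≤ Algebra.trdeg ℚ
            ↥(IntermediateField.adjoin ℚ (Set.range y ∪ Set.range α))) ↔ SchanuelRank l := by
  refine ⟨fun h => ?_, fun hS s₀ s₁ t₀ t₁ u _ _ _ ht₁ _ h1 h2 _ y α hy hα hhyp =>
    le_trdeg_of_royHypothesis_nguyen hS ht₁ h1 h2 hy hα hhyp⟩
  obtain ⟨hs₀, hs₁, ht₀, ht₁, hu, h1, h2, h3⟩ := royAdmissible_example
  exact schanuelRank_of_criterion_roy royAdmissible_example (h _ _ _ _ _ hs₀ hs₁ ht₀ ht₁ hu h1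
    (lt_of_le_of_lt (min_le_left _ _) (lt_of_le_of_lt (le_max_left _ _) h2)) h3)

/-! ### Beyond (2♯): for `t₀ + t₁ < s₀` the criterion is vacuous (`royCriterionAt_of_lt_s₀`) -/

/-- **The first half of [Nguyen2009, Theorem 1.4], read literally, is equivalent to Schanuel's
conjecture.**  Literal reading: "if Conjecture 1.3 is true for some positive integer `l` and some
choice of parameters satisfying (2), then Schanuel's conjecture is true for this value of `l`" —
i.e. for EVERY `p` in window (2), criterion at `p` (rank `l`) ⇒ Schanuel (rank `l`) (rank `0`
included harmlessly: both sides hold there).  Window (2) contains `p = (2, 31/50, 6/5, 1/2, 13/10)`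
with `t₀ + t₁ = 17/10 < s₀ = 2`, at which Conjecture 1.3 holds vacuously (`royCriterionAt_of_lt_s₀`,
tree file `SoloBlindPadeExponent`).  What the printed proof establishes is `nguyen_thm14_sharp`; compare Roy's window, where the
pointwise and the `∀` readings agree (`Roy2001_iff_holds`, `nguyen_thm14_forall`).
[cite: Nguyen2009, Thm. 1.4] -/
theorem nguyen_thm14_literal_iff_schanuel :
    (∀ (l : ℕ) (s₀ s₁ t₀ t₁ u : ℝ), 0 < s₀ → 0 < s₁ → 0 < t₀ → 0 < t₁ → 0 < u →
      max 1 (max t₀ (2 * t₁)) < min s₀ (2 * s₁) → min s₀ (2 * s₁) < u → u < (1 + t₀ + t₁) / 2 →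
      (∀ (y α : Fin l → ℂ), LinearIndependent ℚ y → (∀ j, α j ≠ 0) →
        RoyHypothesis y α s₀ s₁ t₀ t₁ u →
          (l : Cardinal) ≤ Algebra.trdeg ℚ
            ↥(IntermediateField.adjoin ℚ (Set.range y ∪ Set.range α))) →
      SchanuelRank l) ↔ _root_.Schanuel := by
  have h0 : _root_.Schanuel ↔ ∀ l, SchanuelRank l := Iff.rfl
  rw [h0]
  constructor
  · intro h l
    refine h l 2 (31/50) (6/5) (1/2) (13/10) (by norm_num) (by norm_num) (by norm_num)
      (by norm_num) (by norm_num) ?_ ?_ (by norm_num)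
      (royCriterionAt_of_lt_s₀ l (by norm_num) (by norm_num) (by norm_num))
    · simp only [max_lt_iff, lt_min_iff]; norm_num
    · simp only [min_lt_iff]; norm_num
  · intro hS l _ _ _ _ _ _ _ _ _ _ _ _ _ _
    exact hS l

/-! ### Beyond (2♯) in the `s₁` direction: the construction tool does not run -/

/-- On the part `s₁ + t₁ > ½(1 + t₀ + t₁)` of window (2) the hypotheses of the construction tool
(Roy 2001, Thm. 3 = Waldschmidt: `log((T₀+1)(T₁+1)) + Δ + T₀ log(e r) + e r T₁ ≤ U` and
`(8U)² ≤ Δ T₀ T₁`) cannot be met with Nguyen's choice `Δ = N`, `r = 1 + cN^{s₁}` (`c > 0`: a disc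
containing the translates `m y`, `m ≤ N^{s₁}`, `y ≠ 0`), `T₀ = N^{t₀}`, `T₁ = N^{t₁}`, for ANY
smallness target `U`, once `N` is large: `U ≥ c N^{s₁ + t₁}` contradicts `64 U² ≤ N^{1 + t₀ + t₁}`.
[cite: Roy2001, Thm. 3; Nguyen2009, Thm. 2.2, p. 28] -/
theorem thm3_numerology_eventually_false {s₁ t₀ t₁ c : ℝ} (hc : 0 < c)
    (h : (1 + t₀ + t₁) / 2 < s₁ + t₁) :
    ∀ᶠ N : ℕ in atTop, ∀ U : ℝ,
      Real.log ((((N : ℝ) ^ t₀ + 1)) * ((N : ℝ) ^ t₁ + 1)) + N +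
          (N : ℝ) ^ t₀ * Real.log (Real.exp 1 * (1 + c * (N : ℝ) ^ s₁)) +
          Real.exp 1 * (1 + c * (N : ℝ) ^ s₁) * (N : ℝ) ^ t₁ ≤ U →
        ¬ ((8 * U) ^ 2 ≤ (N : ℝ) * (N : ℝ) ^ t₀ * (N : ℝ) ^ t₁) := by
  have h2 : 1 + t₀ + t₁ < 2 * (s₁ + t₁) := by linarith
  have hD : (0 : ℝ) < 64 * c ^ 2 := by positivity
  have H : ∀ᶠ x : ℝ in atTop, 2 * x ^ (1 + t₀ + t₁) ≤ (64 * c ^ 2) * x ^ (2 * (s₁ + t₁)) :=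
    eventually_mul_rpow_le_mul_rpow 2 h2 hD
  filter_upwards [tendsto_natCast_atTop_atTop.eventually H, eventually_ge_atTop 1] with N hN hN1
  intro U hU hsq
  have hx1 : (1 : ℝ) ≤ (N : ℝ) := by exact_mod_cast hN1
  have hx0 : (0 : ℝ) < (N : ℝ) := by linarith
  have hE : (1 : ℝ) ≤ Real.exp 1 := by have := Real.add_one_le_exp (1 : ℝ); linarith
  have ht₀' : 0 ≤ (N : ℝ) ^ t₀ := Real.rpow_nonneg hx0.le t₀
  have ht₁' : 0 ≤ (N : ℝ) ^ t₁ := Real.rpow_nonneg hx0.le t₁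
  have hs₁' : 0 ≤ c * (N : ℝ) ^ s₁ := mul_nonneg hc.le (Real.rpow_nonneg hx0.le s₁)
  -- the three other terms are nonnegative
  have hA : 0 ≤ Real.log (((N : ℝ) ^ t₀ + 1) * ((N : ℝ) ^ t₁ + 1)) :=
    Real.log_nonneg (by nlinarith)
  have hB : 0 ≤ (N : ℝ) ^ t₀ * Real.log (Real.exp 1 * (1 + c * (N : ℝ) ^ s₁)) :=
    mul_nonneg ht₀' (Real.log_nonneg (by nlinarith))
  have hst : (N : ℝ) ^ (s₁ + t₁) = (N : ℝ) ^ s₁ * (N : ℝ) ^ t₁ := Real.rpow_add hx0 _ _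
  have hpos : 0 ≤ (N : ℝ) ^ (s₁ + t₁) := Real.rpow_nonneg hx0.le _
  -- `U ≥ c N^{s₁+t₁}`
  have hU' : c * (N : ℝ) ^ (s₁ + t₁) ≤ U := by
    have ht : 0 ≤ (N : ℝ) ^ t₁ := Real.rpow_nonneg hx0.le _
    have : c * (N : ℝ) ^ (s₁ + t₁) ≤ Real.exp 1 * (1 + c * (N : ℝ) ^ s₁) * (N : ℝ) ^ t₁ := by
      rw [hst]
      have hs' : 0 ≤ (N : ℝ) ^ s₁ := Real.rpow_nonneg hx0.le _
      nlinarith [mul_nonneg hs' ht, mul_nonneg (mul_nonneg hc.le hs') ht]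
    linarith
  -- square and compare exponents
  have hsq' : (N : ℝ) ^ (2 * (s₁ + t₁)) = ((N : ℝ) ^ (s₁ + t₁)) ^ 2 := by
    rw [mul_comm, Real.rpow_mul hx0.le, Real.rpow_two]
  have hprod : (N : ℝ) * (N : ℝ) ^ t₀ * (N : ℝ) ^ t₁ = (N : ℝ) ^ (1 + t₀ + t₁) := by
    rw [Real.rpow_add hx0, Real.rpow_add hx0, Real.rpow_one]
  have hcU : (c * (N : ℝ) ^ (s₁ + t₁)) ^ 2 ≤ U ^ 2 := by
    have hcp : 0 ≤ c * (N : ℝ) ^ (s₁ + t₁) := mul_nonneg hc.le hpos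
    exact pow_le_pow_left₀ hcp hU' 2
  rw [hprod] at hsq
  rw [hsq'] at hN
  have hxp : 0 < (N : ℝ) ^ (1 + t₀ + t₁) := Real.rpow_pos_of_pos hx0 _
  nlinarith

end Summit.Schanuel.Schanuel.Theorems

end
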